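import Summits.Ventures.CertifiedManyBodySolver.Downfold.TPrimePinnedPairRowKernelChainQuotAdjNear
import Summits.Ventures.CertifiedManyBodySolver.Rows.CorrWindowBoxHamiltonian
import Summits.Ventures.CertifiedManyBodySolver.Rows.CorrWindowCertDictionaryFsumWide
import HarnessLib

/-!
# The PINNED t′-PAIR shape ON THE BOX GEOMETRY OF RECORD: `SquareTTPrimePinnedPairRowT.of_quotAdjChainNearKernelCertsG_box` — the wide
# Near/quotAdj pair consumer with EVERY table / letter / window hypothesis DISCHARGED generically in `(r, R, vmax)` on hubbard-obs-p2's
# `BoxGeom.boxQuot r R vmax` (`Rows/CorrWindowBoxGeometry.lean`, p677965), plus the three dictionary dischargers in box form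
# (cell `pub/hubbard-obs` × `pub/hubbard-downfold`, D-0154 (1)(C) COVERAGE La214; seat `hubbard-cov-la214-unc-2`, lineage desk; zero compute)

HONEST FRAMING: Lean plumbing towards «tier P» for PAIR claim nodes‴. The wide T pair consumer of the closer-of-record input shape
(`Downfold/TPrimePinnedPairRowKernelChainQuotAdjNear.lean` §1) asks the instance for sixteen geometry facts (`h7 hΛ h8 h0 hz hxs hix hxsβ hcovβ hd
hdx hdΛ hf hsp hokV ho`); on the exporter's geometry of record — outer table `boxW R`, inner window `boxW r`, licensed shifts `‖v‖∞ ≤ vmax`,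
tables `BoxGeom.boxQuot r R vmax`, letters `BoxGeom.boxD R` / `boxD r`, origin letters `orb (boxIx R 0) σ` — every one of them is a theorem
in `(r, R, vmax)` under `7 ≤ R`, `r + 1 ≤ R`, `r + vmax ≤ R` (hubbard-obs-p2's `boxXs_mem / boxXs_boxIx / boxXs_injective / boxD_orb /
boxD_injective / boxD_boxPush / box_hokV / boxQuot_hcovβ / boxQuot_hdΛ / boxW_mono / thicken_boxW_subset / thicken_zero_one_eq / zero_mem_boxW`).
§1 records the small window facts the pair shape adds to hubbard-obs-p2's (`boxW_eq_box` / `box_subset_boxW` are theirs, `Rows/CorrWindowBoxHamiltonian.lean`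
p680316): the energy window, the thickened inner window, read-back on sub-windows, the origin letter; §2 the three DICTIONARY
DISCHARGERS in box form (`termOp (boxD R) (hamTermsIdx 1 tp U (boxXs R)) = H_{boxW R}`, `… (energyTermsIdx 1 tp U (boxIx R)) = Γ(incl)(energy word)`,
`… (fsumTermsIdx tp (boxIx R)) = Γ(incl)(−X₀(tp))` — hubbard-obs-p2's `termOp_hamTermsIdx` / `termOp_energyTermsIdx` and this base's
`termOp_fsumTermsIdx_wide` at the box tables) plus the kernel-cheap Hamiltonian word of record `hamTermsBox R 1 tp U` (hubbard-obs-p2's (P2′),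
`termOp_hamTermsBox`) at `t = 1` for the same `hH_v` slot; §3 the BOX EDITION: the instance supplies `(r R vmax)` with three `norm_num` inequalities,
the station,
`Bkey`, `X`, `EB`, and per vertex ONLY the certificate data (`TH hH TE hE TX hX μ ν κ cap κ' fl TGs hΛm O hTG masks hfar CW hcw AV ns M Cs hC0 Hs
hchain hβ`). Nothing is asserted: no `def`, no named fact, no `sorry`, no number; no chain of record exists (nothing evaluated); CONTROL /
CALIBRATION wording class (xx1); no summit statement is proved by this file.

References: X. Han, arXiv:2006.06002 §3 (square-lattice windows) [Han2020Bootstrap]; S. Friedli, Y. Velenik, *Statistical Mechanics of Lattice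
Systems* §3.2 (the boxes `B(n)`) [FriedliVelenikSMLS2017]; J. Wang et al., PRX 14 (2024) 031006 §III [WangEtAl2024]; C. Jansson, D. Chaykin, C. Keil,
SIAM J. Numer. Anal. 46 (2008) 180 [JanssonChaykinKeil2008]; D. J. Scalapino, S. R. White, S. Zhang, Phys. Rev. B 47 (1993) 7995 §II
[ScalapinoWhiteZhang1993].
-/

noncomputable section

namespace Summit.Ventures.CertifiedManyBodySolver.Downfold

open Literature.MathematicalPhysics.QuantumLattice
open Matrix HubbardWave0 Literature.Probability.LatticeModels ThermodynamicLimit Filter Topology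
open Literature.MathematicalPhysics.QuantumManyBody.StateRelaxation
open Summit.Ventures.CertifiedQuantumChemistry Summit.Ventures.CertifiedQuantumChemistry.CARPoly
open Summit.Ventures.CertifiedManyBodySolver.CARPolyWindow Summit.Ventures.CertifiedManyBodySolver.CARPolyWindow.BoxGeom
open Summit.Ventures.CertifiedManyBodySolver.Observables
open scoped BigOperators ComplexOrder

/-! ## §1 Window facts the pair shape adds to the box geometry -/

section BoxFacts

/-- The energy word's window `thicken {0} 1` lies in every outer table `boxW R`, `R ≥ 1` (the `h0` hypothesis). [cite: Han2020Bootstrap, §3] -/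
theorem thicken01_subset_boxW {R : ℕ} (h : 1 ≤ R) : thicken ({0} : Finset (Site 2)) 1 ⊆ boxW R := by
  rw [thicken_zero_one_eq]; exact boxW_mono h

/-- The thickened inner window lies in the outer table for `r + 1 ≤ R` (the `h8` hypothesis). [cite: Han2020Bootstrap, §3] -/
theorem thicken_boxW_subset_boxW {r R : ℕ} (h : r + 1 ≤ R) : thicken (boxW r) 1 ⊆ boxW R :=
  (thicken_boxW_subset r).trans (boxW_mono h)

/-- Read-back on any sub-window of the outer table. [folklore] -/
theorem boxXs_boxIx_of_subset {R : ℕ} {A : Finset (Site 2)} (hA : A ⊆ boxW R) : ∀ v ∈ A, boxXs R (boxIx R v) = v :=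
  fun v hv => boxXs_boxIx R v (hA hv)

/-- Membership-proof irrelevance for ordered sites. [folklore] -/
private theorem pt_congr_boxSite {Λ : Finset (Site 2)} {x y : Site 2} (hx : x ∈ Λ) (hy : y ∈ Λ) (h : x = y) :
    PolySite.pt x hx = PolySite.pt y hy := by
  subst h; rfl

/-- **The origin letters of the box tables**: `boxD R (orb (boxIx R 0) σ)` IS the orbital `(0, σ)` of `boxW R` (the `ho` hypothesis). [folklore] -/
theorem boxD_orb_boxIx_zero (R : ℕ) (σ : Fin 2) : boxD R (orb (boxIx R 0) σ) = orb (PolySite.pt 0 (zero_mem_boxW R)) σ := by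
  rw [boxD_orb, pt_congr_boxSite (boxXs_mem R _) (zero_mem_boxW R) (boxXs_boxIx R 0 (zero_mem_boxW R))]

end BoxFacts

/-! ## §2 The three dictionaries in box form (dischargers of `hH_v`, `hE_v`, `hX_v`) -/

section BoxDictionaries

/-- **Hamiltonian dictionary, box form**: `termOp (boxD R) (hamTermsIdx 1 tp U (boxXs R)) = H^{(1,tp,U)}_{boxW R}`. [cite: Han2020Bootstrap, §3] -/
theorem termOp_boxD_hamTermsIdx (R : ℕ) (tp U : ℚ) :
    termOp (boxD R) (hamTermsIdx 1 tp U (boxXs R)) = (hubbardTTPrimeFermionInteraction 1 (tp : ℝ) (U : ℝ)).localHamiltonian (boxW R) := by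
  have h := termOp_hamTermsIdx 1 tp U (boxXs R) (boxXs_mem R) (boxXs_injective R) (boxXs_cover R) (boxD R) (boxD_orb R)
  rwa [Rat.cast_one] at h

/-- **Hamiltonian dictionary, box form, KERNEL-CHEAP WORD OF RECORD** (hubbard-obs-p2's (P2′) `hamTermsBox`, per-site offsets, no `N²` adjacency):
`termOp (boxD R) (hamTermsBox R 1 tp U) = H^{(1,tp,U)}_{boxW R}` — the same `hH_v` slot. [cite: Han2020Bootstrap, §3] -/
theorem termOp_boxD_hamTermsBox (R : ℕ) (tp U : ℚ) :
    termOp (boxD R) (hamTermsBox R 1 tp U) = (hubbardTTPrimeFermionInteraction 1 (tp : ℝ) (U : ℝ)).localHamiltonian (boxW R) := by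
  have h := termOp_hamTermsBox R 1 tp U
  rwa [Rat.cast_one] at h

/-- **Energy dictionary, box form** (`R ≥ 1`): `termOp (boxD R) (energyTermsIdx 1 tp U (boxIx R)) = Γ(incl)(energy word at (1,tp,U))`.
[cite: Han2020Bootstrap, §3] -/
theorem termOp_boxD_energyTermsIdx {R : ℕ} (hR : 1 ≤ R) (tp U : ℚ) :
    termOp (boxD R) (energyTermsIdx 1 tp U (boxIx R)) =
      fermionEmbed (PolySite.incl (thicken01_subset_boxW hR)) ((hubbardTTPrimeFermionInteraction 1 (tp : ℝ) (U : ℝ)).meanEnergyObs 1) := by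
  have h := termOp_energyTermsIdx 1 tp U (boxXs R) (boxXs_mem R) (thicken01_subset_boxW hR) (boxIx R)
    (boxXs_boxIx_of_subset (thicken01_subset_boxW hR)) (boxD R) (boxD_orb R)
  rwa [Rat.cast_one] at h

/-- **Objective dictionary, box form** (`R ≥ 7`): `termOp (boxD R) (fsumTermsIdx tp (boxIx R)) = Γ(incl h7)(−X₀(tp))` — the own f-sum objective of the
T pair (this base's `termOp_fsumTermsIdx_wide` at the box tables). [cite: ScalapinoWhiteZhang1993, §II] -/
theorem termOp_boxD_fsumTermsIdx {R : ℕ} (hR : 7 ≤ R) (tp : ℚ) (U : ℝ) :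
    termOp (boxD R) (fsumTermsIdx tp (boxIx R)) = fermionEmbed (PolySite.incl (box_subset_boxW hR)) (-oddMomentObsTT (tp : ℝ) U 0) :=
  termOp_fsumTermsIdx_wide tp U (box_subset_boxW hR) (boxXs R) (boxXs_mem R) (boxIx R)
    (boxXs_boxIx_of_subset ((box_subset_box (by norm_num) : box 2 1 ⊆ box 2 7).trans (box_subset_boxW hR))) (boxD R) (boxD_orb R)

/-- **Objective dictionary, box form, with the hopping literal pre-cast** (`htp : (tp : ℝ) = tpR`): for a CONSTANT objective family (e.g. the K2
corner objective `fun _ => −X₀(−3/10)`) the instance states `X` with a real literal; this variant removes the `((−3/10 : ℚ) : ℝ)` cast line.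
[cite: ScalapinoWhiteZhang1993, §II] -/
theorem termOp_boxD_fsumTermsIdx_cast {R : ℕ} (hR : 7 ≤ R) (tp : ℚ) (tpR U : ℝ) (htp : (tp : ℝ) = tpR) :
    termOp (boxD R) (fsumTermsIdx tp (boxIx R)) = fermionEmbed (PolySite.incl (box_subset_boxW hR)) (-oddMomentObsTT tpR U 0) := by
  rw [← htp]; exact termOp_boxD_fsumTermsIdx hR tp U

end BoxDictionaries

/-! ## §3 THE BOX EDITION of the wide Near/quotAdj pair consumer -/

section KernelPairBox

/-- **KERNEL FORM OF THE PAIR NODE‴ ON THE BOX GEOMETRY OF RECORD** — `D := boxQuot r R vmax`, `Λ := boxW r ⊆ Λ' := boxW R`, letters `boxD R` /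
`boxD r`, origin letters `orb (boxIx R 0) σ`, spins read syntactically; ALL table / letter / window hypotheses of
`SquareTTPrimePinnedPairRowT.of_quotAdjChainNearKernelCertsG_wide` discharged by the box-geometry theorems under `7 ≤ R`, `r + 1 ≤ R`,
`r + vmax ≤ R`. Per vertex the instance supplies the certificate data only: dictionaries `TH hH TE hE` (§2 or any cheaper word with the same
semantics), the objective `TX` with `hX : termOp (boxD R) TX = Γ(incl)(X s_v)` (own f-sum objective: `termOp_boxD_fsumTermsIdx`), the rows
`μ ν κ cap κ' fl`, Gram slices `TGs` with `hTG` and `Λm ⪰ 0`, eom-near `masks` with `hfar`, `CW hcw AV`, the `stepEQA` chain `ns M Cs hC0 Hs hchain`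
over `residTGslicesNear … (boxPush r R) EB masks …`, and the price `hβ`
⟹ `SquareTTPrimePinnedPairRowT U n₀ sA sB capA capB flA flB βA κA κA' βB κB κB' X`.
[cite: WangEtAl2024, §III] [cite: Han2020Bootstrap, §3] [cite: JanssonChaykinKeil2008, §3] -/
theorem SquareTTPrimePinnedPairRowT.of_quotAdjChainNearKernelCertsG_box
    (r R vmax : ℕ) (h7R : 7 ≤ R) (hrR : r + 1 ≤ R) (hvR : r + vmax ≤ R)
    (U : ℚ) (hU : 0 ≤ U) (n₀ : ℚ) (hn0 : 0 ≤ n₀) (hn2 : n₀ < 2) (sA sB : ℚ) (Bkey : ℕ)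
    -- the objective family and the SHARED eom words (inner letters)
    (X : ℝ → FermionOp (box 2 7)) (EB : List (Terms (Orb (Fin (boxN r)))))
    -- vertex A
    (THA : Terms (Orb (Fin (boxN R))))
    (hHA : termOp (boxD R) THA = (hubbardTTPrimeFermionInteraction 1 (sA : ℝ) (U : ℝ)).localHamiltonian (boxW R))
    (TEA : Terms (Orb (Fin (boxN R))))
    (hEA : termOp (boxD R) TEA =
      fermionEmbed (PolySite.incl (thicken01_subset_boxW (le_trans (by norm_num) h7R)))
        ((hubbardTTPrimeFermionInteraction 1 (sA : ℝ) (U : ℝ)).meanEnergyObs 1))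
    (TXA : Terms (Orb (Fin (boxN R)))) (hXA : termOp (boxD R) TXA = fermionEmbed (PolySite.incl (box_subset_boxW h7R)) (X (sA : ℝ)))
    (μA : Fin 2 → ℚ) (νA κA capA κA' flA : ℚ)
    (TGsA : List (Terms (Orb (Fin (boxN R))))) {mA : Type*} [Fintype mA] [DecidableEq mA] {ΛmA : Matrix mA mA ℂ}
    (hΛmA : ΛmA.PosSemidef) (OA : mA → FermionOp (boxW R)) (hTGA : termOp (boxD R) TGsA.flatten = gramForm ΛmA OA)
    (masksA : List (List Bool)) (hfarA : eomFarOK THA (boxPush r R) EB masksA = true)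
    (CWA : Terms (Orb (Fin (boxN R)))) (hcwA : ∀ wc ∈ CWA, chargeW wc.1 ≠ 0 ∨ spinChargeW (fun a => (ofLex a).2) wc.1 ≠ 0)
    (AVA : List (Terms (Orb (Fin (boxN R)))))
    (nsA : List ℕ) (MA : ℕ) (CsA : List SOSDual.EncPoly) (hC0A : CsA.getD 0 [] = []) (HsA : List (List (QHint (boxN r))))
    (hchainA : ChainQAOK (boxQuot r R vmax) Bkey MA CsA
      (groupSlices (residTGslicesNear TXA μA νA (fun σ => orb (boxIx R 0) σ) κA capA κA' flA TEA TGsA THA (boxPush r R) EB masksA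
        (fun l : Fin 0 => l.elim0) (fun l : Fin 0 => l.elim0) CWA AVA) nsA) HsA)
    {βA : ℚ}
    (hβA : haveI := neZero_boxN R; βA ≤ lowerConst (SOSDual.decPoly (boxN R) (CsA.getD MA [])) + (μA 0 + μA 1) * (n₀ / 2 - νA))
    -- vertex B
    (THB : Terms (Orb (Fin (boxN R))))
    (hHB : termOp (boxD R) THB = (hubbardTTPrimeFermionInteraction 1 (sB : ℝ) (U : ℝ)).localHamiltonian (boxW R))
    (TEB : Terms (Orb (Fin (boxN R))))
    (hEB : termOp (boxD R) TEB =
      fermionEmbed (PolySite.incl (thicken01_subset_boxW (le_trans (by norm_num) h7R)))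
        ((hubbardTTPrimeFermionInteraction 1 (sB : ℝ) (U : ℝ)).meanEnergyObs 1))
    (TXB : Terms (Orb (Fin (boxN R)))) (hXB : termOp (boxD R) TXB = fermionEmbed (PolySite.incl (box_subset_boxW h7R)) (X (sB : ℝ)))
    (μB : Fin 2 → ℚ) (νB κB capB κB' flB : ℚ)
    (TGsB : List (Terms (Orb (Fin (boxN R))))) {mB : Type*} [Fintype mB] [DecidableEq mB] {ΛmB : Matrix mB mB ℂ}
    (hΛmB : ΛmB.PosSemidef) (OB : mB → FermionOp (boxW R)) (hTGB : termOp (boxD R) TGsB.flatten = gramForm ΛmB OB)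
    (masksB : List (List Bool)) (hfarB : eomFarOK THB (boxPush r R) EB masksB = true)
    (CWB : Terms (Orb (Fin (boxN R)))) (hcwB : ∀ wc ∈ CWB, chargeW wc.1 ≠ 0 ∨ spinChargeW (fun a => (ofLex a).2) wc.1 ≠ 0)
    (AVB : List (Terms (Orb (Fin (boxN R)))))
    (nsB : List ℕ) (MB : ℕ) (CsB : List SOSDual.EncPoly) (hC0B : CsB.getD 0 [] = []) (HsB : List (List (QHint (boxN r))))
    (hchainB : ChainQAOK (boxQuot r R vmax) Bkey MB CsB
      (groupSlices (residTGslicesNear TXB μB νB (fun σ => orb (boxIx R 0) σ) κB capB κB' flB TEB TGsB THB (boxPush r R) EB masksB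
        (fun l : Fin 0 => l.elim0) (fun l : Fin 0 => l.elim0) CWB AVB) nsB) HsB)
    {βB : ℚ}
    (hβB : haveI := neZero_boxN R; βB ≤ lowerConst (SOSDual.decPoly (boxN R) (CsB.getD MB [])) + (μB 0 + μB 1) * (n₀ / 2 - νB))
    : SquareTTPrimePinnedPairRowT (U : ℝ) (n₀ : ℝ) (sA : ℝ) (sB : ℝ) capA capB flA flB βA κA κA' βB κB κB' X := by
  haveI : NeZero (boxN R) := neZero_boxN R
  have hrR' : r ≤ R := by omega
  exact SquareTTPrimePinnedPairRowT.of_quotAdjChainNearKernelCertsG_wide U hU n₀ hn0 hn2 sA sB (box_subset_boxW h7R) (boxW_mono hrR')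
    (thicken_boxW_subset_boxW hrR) (thicken01_subset_boxW (le_trans (by norm_num) h7R)) (zero_mem_boxW R)
    (boxQuot r R vmax) (boxXs_mem R) (fun y hy => boxXs_boxIx R y hy) (boxXs_mem r) (boxQuot_hcovβ r R vmax)
    (boxD R) (boxD_injective R) (boxD_orb R) Bkey (boxD r) (boxQuot_hdΛ r R vmax) (fun b => boxD_boxPush hrR' b)
    (fun a => (ofLex a).2) (boxD_spin R) (fun γc v hok j => box_hokV hvR γc v hok j) (fun σ => orb (boxIx R 0) σ) (boxD_orb_boxIx_zero R) X EB
    THA hHA TEA hEA TXA hXA μA νA κA capA κA' flA TGsA hΛmA OA hTGA masksA hfarA CWA hcwA AVA nsA MA CsA hC0A HsA hchainA hβA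
    THB hHB TEB hEB TXB hXB μB νB κB capB κB' flB TGsB hΛmB OB hTGB masksB hfarB CWB hcwB AVB nsB MB CsB hC0B HsB hchainB hβB

end KernelPairBox

end Summit.Ventures.CertifiedManyBodySolver.Downfold

end
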